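import Summits.NavierStokesRegularity.FluidComputer.ClayBlowup
import Literature.Analysis.FluidPDE.SereginSverak2002PressureLowerBound
import HarnessLib

/-!
# LOCAL ZOOM DATA at a singular point of a Clay blow-up WITH force: distance-weighted
# near-maxima (weight exponent 2), so that the rescaled radius grows AND the far-field Duhamel
# budget vanishes

Cell `ns-blowup`, seat `ns-blowup-ecbridge-2` (g11; the E–C endpoint theory seat). LABEL: E–C typing
(KERNEL — no named fact, no new definition). WHAT THIS IS NOT: not Navier–Stokes evidence — a
selection lemma about the TYPE `ClayBlowup ν`; no inhabitant is claimed. Companion memo: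
`run/shared/lean/pub/ns-blowup/ecbridge2/ECBRIDGE-2-MEMO-10.md`.

## Why the weight

g10's zoom (`ClayBlowup.exists_zoom_limit`, KNSS 2009 Prop. 6.1 WITH force) is GLOBAL: it zooms at
near-maxima of `|u|` over the whole space, which may sit at another singular point. To zoom at a
PRESCRIBED singular point `x₁` one maximises, over `[t_b, t_k] × B̄(x₁, r')`, the weighted amplitude
`Φ(τ, y) = (r' − |y − x₁|)² ‖u(τ, y)‖` (the classical distance-weight of interior estimates by blow-up).
At a maximiser `(τ_k, y_k)` with `M_k = ‖u(τ_k, y_k)‖`, `d_k = r' − |y_k − x₁| > 0`, the solution is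
bounded by `4 M_k` on `[t_b, τ_k] × B(y_k, d_k/2)` (there the weight is `≥ (d_k/2)²`), and
`Φ_k = d_k² M_k → ∞` because `x₁` is singular. In the parabolic zoom of scale `c_k = M_k⁻¹` this
gives a field bounded by `4` on a backward region of rescaled radius `d_k M_k / 2 → ∞`, while the
far-field Duhamel budget of the energy `E` at physical distance `d_k/2`, namely `16 E/(d_k⁴ M_k³)`
in units of `M_k` (Koch–Tataru's kernel bound `C (√σ + |z|)^{-4}`, integrated over a lag `M_k⁻²`),
VANISHES: `d⁴M³ = (d²M)² M → ∞`. The exponent `2` is the smallest integer exponent `≥ 4/3` with this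
property (exponent `1`, the plain distance weight, only gives `dM → ∞`).

* `ClayBlowup.exists_weighted_near_max` — for `X : ClayBlowup ν`, a point `x₁` which is
  NOT backward bounded, a radius `r' > 0` and a base time `t_b ∈ [0, T)`: for every level `L` there
  are `τ ∈ [t_b, T)` and `y ∈ B(x₁, r')` with `(r' − |y − x₁|)² ‖u(τ, y)‖ ≥ L` which maximise the
  weighted amplitude over `[t_b, τ] × B̄(x₁, r')`;
* `ClayBlowup.norm_le_four_mul_of_weighted_max` — at such a maximiser, `‖u(s, z)‖ ≤ 4 ‖u(τ, y)‖` for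
  `s ∈ [t_b, τ]`, `z ∈ B(y, (r' − |y − x₁|)/2)`;
* `ClayBlowup.exists_local_zoom_data` — the sequence form: `τ_k`, `y_k` with
  `(k + 1) ≤ d_k² M_k`, the maximality, the bound `4 M_k` on `[t_b, τ_k] × B(y_k, d_k/2)`, `M_k ≥ 1`.

References: G. Koch, N. Nadirashvili, G. Seregin, V. Šverák, Acta Math. 203 (2009), §6 (6.2)–(6.3)
[cite: KochNadirashviliSereginSverak2009, §6 (6.2)–(6.3)]; the distance-weighted maximum is the
standard device of interior estimates by rescaling (e.g. KNSS 2009, proof of Thm. 6.2, the choice of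
the cylinders). [cite: KochNadirashviliSereginSverak2009, proof of Thm 6.2 (arXiv p. 13)]
-/

noncomputable section

namespace Summit.NavierStokesRegularity.FluidComputer

open Set MeasureTheory Filter Topology Function Metric
open scoped ENNReal NNReal
open Literature.Analysis Literature.Analysis.FluidPDE
open Summit.NavierStokesRegularity.NavierStokesRegularity

namespace ClayBlowup

variable {ν : ℝ} (X : ClayBlowup ν)

/-! ## §1 One weighted near-maximum above any level -/

/-- **A weighted near-maximum above any prescribed level at a point which is not backward bounded**
(no named fact; any `ν`). Weight `(r' − |y − x₁|)²` on the closed ball `B̄(x₁, r')`, times in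
`[t_b, τ]`; the maximiser exists by compactness and continuity of the classical solution below `T`,
and its value exceeds `L` because `u` is unbounded on every backward cylinder at `(T, x₁)`.
[cite: KochNadirashviliSereginSverak2009, §6 (6.2)–(6.3) and proof of Thm 6.2 (arXiv pp. 11, 13)] -/
theorem exists_weighted_near_max {x₁ : EuclideanSpace ℝ (Fin 3)}
    (hx₁ : ¬ IsBackwardBoundedAt X.u X.T x₁) {r' t_b : ℝ} (hr' : 0 < r') (ht_b : t_b ∈ Ico 0 X.T)
    (L : ℝ) :
    ∃ τ ∈ Ico t_b X.T, ∃ y ∈ ball x₁ r',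
      L ≤ (r' - dist y x₁) ^ 2 * ‖X.u τ y‖ ∧
      ∀ s ∈ Icc t_b τ, ∀ z ∈ closedBall x₁ r',
        (r' - dist z x₁) ^ 2 * ‖X.u s z‖ ≤ (r' - dist y x₁) ^ 2 * ‖X.u τ y‖ := by
  have hT := X.T_pos
  -- ### a point of the small backward cylinder at `(T, x₁)` where `u` is large
  set ρ : ℝ := min (r' / 2) (Real.sqrt (X.T - t_b)) with hρ
  have hTt : 0 < X.T - t_b := sub_pos.2 ht_b.2
  have hρpos : 0 < ρ := lt_min (by positivity) (Real.sqrt_pos.2 hTt)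
  have hρr : ρ ≤ r' / 2 := min_le_left _ _
  have hρt : X.T - ρ ^ 2 ≥ t_b := by
    have : ρ ^ 2 ≤ Real.sqrt (X.T - t_b) ^ 2 := pow_le_pow_left₀ hρpos.le (min_le_right _ _) 2
    rw [Real.sq_sqrt hTt.le] at this
    linarith
  have hbig : ∃ s ∈ Ioo (X.T - ρ ^ 2) X.T, ∃ z ∈ ball x₁ ρ,
      (max L 0 + 1) * (4 / r' ^ 2) < ‖X.u s z‖ := by
    by_contra h
    push Not at h
    exact hx₁ ⟨ρ, hρpos, (max L 0 + 1) * (4 / r' ^ 2), fun s hs z hz => h s hs z hz⟩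
  obtain ⟨s, hs, z, hz, hsz⟩ := hbig
  have hs_tb : t_b ≤ s := hρt.le.trans hs.1.le
  -- the weight at `z` is at least `(r'/2)²`
  have hwz : (r' / 2) ^ 2 ≤ (r' - dist z x₁) ^ 2 := by
    have h1 : dist z x₁ < r' / 2 := (mem_ball.1 hz).trans_le hρr
    have h2 : r' / 2 ≤ r' - dist z x₁ := by linarith
    exact pow_le_pow_left₀ (by positivity) h2 2
  have hΦz : max L 0 + 1 ≤ (r' - dist z x₁) ^ 2 * ‖X.u s z‖ := by
    have h1 : (max L 0 + 1) * (4 / r' ^ 2) * (r' / 2) ^ 2 = max L 0 + 1 := by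
      field_simp
      ring
    calc max L 0 + 1 = (max L 0 + 1) * (4 / r' ^ 2) * (r' / 2) ^ 2 := h1.symm
      _ ≤ ‖X.u s z‖ * (r' - dist z x₁) ^ 2 := by
          refine mul_le_mul hsz.le hwz (by positivity) (norm_nonneg _)
      _ = _ := mul_comm _ _
  -- ### the maximiser on the compact set `[t_b, s] × B̄(x₁, r')`
  set K : Set (ℝ × EuclideanSpace ℝ (Fin 3)) := Icc t_b s ×ˢ closedBall x₁ r' with hK
  have hKc : IsCompact K := isCompact_Icc.prod (isCompact_closedBall _ _)
  have hzK : (s, z) ∈ K := ⟨⟨hs_tb, le_rfl⟩, ball_subset_closedBall (ball_subset_ball (by linarith) hz)⟩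
  set Φ : ℝ × EuclideanSpace ℝ (Fin 3) → ℝ := fun q => (r' - dist q.2 x₁) ^ 2 * ‖X.u q.1 q.2‖ with hΦ
  have hΦc : ContinuousOn Φ K := by
    have hu : ContinuousOn (fun q : ℝ × EuclideanSpace ℝ (Fin 3) => X.u q.1 q.2) K := by
      refine X.classical.smooth_velocity.continuousOn.mono fun q hq => ⟨?_, mem_univ _⟩
      exact ⟨ht_b.1.trans hq.1.1, lt_of_le_of_lt hq.1.2 hs.2⟩
    have hw : Continuous fun q : ℝ × EuclideanSpace ℝ (Fin 3) => (r' - dist q.2 x₁) ^ 2 := by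
      fun_prop
    exact hw.continuousOn.mul hu.norm
  obtain ⟨q₀, hq₀K, hq₀max⟩ := hKc.exists_isMaxOn ⟨_, hzK⟩ hΦc
  obtain ⟨⟨hτ₁, hτ₂⟩, hy⟩ := hq₀K
  have hmax : ∀ q ∈ K, Φ q ≤ Φ q₀ := fun q hq => hq₀max hq
  have hL : max L 0 + 1 ≤ Φ q₀ := hΦz.trans (hmax (s, z) hzK)
  -- the maximiser lies in the OPEN ball (its weight is positive)
  have hyball : q₀.2 ∈ ball x₁ r' := by
    rw [mem_ball]
    by_contra h
    push Not at h
    have h1 : r' - dist q₀.2 x₁ = 0 := by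
      have := mem_closedBall.1 hy; linarith
    have : Φ q₀ = 0 := by simp only [hΦ, h1]; ring
    have h2 : (0 : ℝ) ≤ max L 0 := le_max_right _ _
    linarith
  refine ⟨q₀.1, ⟨hτ₁, lt_of_le_of_lt hτ₂ hs.2⟩, q₀.2, hyball, ?_, fun s' hs' z' hz' => ?_⟩
  · exact ((le_max_left L 0).trans (by linarith)).trans hL
  · exact hmax (s', z') ⟨⟨hs'.1, hs'.2.trans hτ₂⟩, hz'⟩

/-- **At a weighted maximiser the solution is bounded by four times the maximal amplitude on the
half-weight ball**: if `(r' − |z − x₁|)²‖u(s, z)‖ ≤ (r' − |y − x₁|)²‖u(τ, y)‖` for all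
`s ∈ [t_b, τ]`, `z ∈ B̄(x₁, r')`, and `y ∈ B(x₁, r')`, then `‖u(s, z)‖ ≤ 4 ‖u(τ, y)‖` for
`s ∈ [t_b, τ]`, `z ∈ B(y, d/2)`, `d = r' − |y − x₁|` (there the weight is `> (d/2)²`).
[cite: KochNadirashviliSereginSverak2009, proof of Thm 6.2 (arXiv p. 13)] -/
theorem norm_le_four_mul_of_weighted_max {x₁ y : EuclideanSpace ℝ (Fin 3)} {r' t_b τ : ℝ}
    (hy : y ∈ ball x₁ r')
    (hmax : ∀ s ∈ Icc t_b τ, ∀ z ∈ closedBall x₁ r',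
      (r' - dist z x₁) ^ 2 * ‖X.u s z‖ ≤ (r' - dist y x₁) ^ 2 * ‖X.u τ y‖)
    {s : ℝ} (hs : s ∈ Icc t_b τ) {z : EuclideanSpace ℝ (Fin 3)}
    (hz : z ∈ ball y ((r' - dist y x₁) / 2)) :
    ‖X.u s z‖ ≤ 4 * ‖X.u τ y‖ := by
  set d : ℝ := r' - dist y x₁ with hd
  have hd0 : 0 < d := sub_pos.2 (mem_ball.1 hy)
  have hzy : dist z y < d / 2 := mem_ball.1 hz
  -- the weight at `z`
  have hwz : d / 2 < r' - dist z x₁ := by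
    have : dist z x₁ ≤ dist z y + dist y x₁ := dist_triangle _ _ _
    rw [hd] at hzy ⊢; linarith
  have hzball : z ∈ closedBall x₁ r' := mem_closedBall.2 (by linarith [hd0])
  have h := hmax s hs z hzball
  have hw2 : (d / 2) ^ 2 ≤ (r' - dist z x₁) ^ 2 := pow_le_pow_left₀ (by positivity) hwz.le 2
  have hd2 : 0 < (d / 2) ^ 2 := by positivity
  -- `(d/2)² ‖u(s,z)‖ ≤ d² ‖u(τ,y)‖ = 4 (d/2)² ‖u(τ,y)‖`
  have h1 : (d / 2) ^ 2 * ‖X.u s z‖ ≤ d ^ 2 * ‖X.u τ y‖ :=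
    (mul_le_mul_of_nonneg_right hw2 (norm_nonneg _)).trans h
  have h2 : d ^ 2 * ‖X.u τ y‖ = (d / 2) ^ 2 * (4 * ‖X.u τ y‖) := by ring
  rw [h2] at h1
  exact le_of_mul_le_mul_left h1 hd2

/-! ## §2 The sequence of local zoom data -/

/-- **LOCAL ZOOM DATA AT A SINGULAR POINT, WITH THE CLAY FORCE** (no named fact): for a
point `x₁` which is not backward bounded, `r' > 0` and `t_b ∈ [0, T)`, there are times
`τ_k ∈ [t_b, T)` and centres `y_k ∈ B(x₁, r')` such that, with `M_k = ‖u(τ_k, y_k)‖` and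
`d_k = r' − |y_k − x₁|`: `k + 1 ≤ d_k² M_k` (so `d_k M_k → ∞` and `d_k⁴ M_k³ → ∞`), `1 ≤ M_k` once
`r' ≤ 1`, the weighted maximality over `[t_b, τ_k] × B̄(x₁, r')`, and `‖u‖ ≤ 4 M_k` on
`[t_b, τ_k] × B(y_k, d_k/2)`. [cite: KochNadirashviliSereginSverak2009, §6 (6.2)–(6.3) and proof of Thm 6.2 (arXiv pp. 11, 13)] -/
theorem exists_local_zoom_data {x₁ : EuclideanSpace ℝ (Fin 3)}
    (hx₁ : ¬ IsBackwardBoundedAt X.u X.T x₁) {r' t_b : ℝ} (hr' : 0 < r') (ht_b : t_b ∈ Ico 0 X.T) :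
    ∃ (τ : ℕ → ℝ) (y : ℕ → EuclideanSpace ℝ (Fin 3)), ∀ k : ℕ,
      τ k ∈ Ico t_b X.T ∧ y k ∈ ball x₁ r' ∧
      (k : ℝ) + 1 ≤ (r' - dist (y k) x₁) ^ 2 * ‖X.u (τ k) (y k)‖ ∧
      (∀ s ∈ Icc t_b (τ k), ∀ z ∈ closedBall x₁ r',
        (r' - dist z x₁) ^ 2 * ‖X.u s z‖ ≤ (r' - dist (y k) x₁) ^ 2 * ‖X.u (τ k) (y k)‖) ∧
      (∀ s ∈ Icc t_b (τ k), ∀ z ∈ ball (y k) ((r' - dist (y k) x₁) / 2),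
        ‖X.u s z‖ ≤ 4 * ‖X.u (τ k) (y k)‖) ∧
      ((k : ℝ) + 1) / r' ^ 2 ≤ ‖X.u (τ k) (y k)‖ := by
  have hsel := fun k : ℕ => X.exists_weighted_near_max hx₁ hr' ht_b ((k : ℝ) + 1)
  choose τ hτ y hy hL hmax using hsel
  refine ⟨τ, y, fun k => ⟨hτ k, hy k, hL k, hmax k, fun s hs z hz =>
    X.norm_le_four_mul_of_weighted_max (hy k) (hmax k) hs hz, ?_⟩⟩
  -- `(k+1)/r'² ≤ M_k` from `d_k ≤ r'`
  have hd : r' - dist (y k) x₁ ≤ r' := by linarith [dist_nonneg (x := y k) (y := x₁)]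
  have hd0 : 0 ≤ r' - dist (y k) x₁ := by linarith [mem_ball.1 (hy k)]
  have h1 : (r' - dist (y k) x₁) ^ 2 ≤ r' ^ 2 := pow_le_pow_left₀ hd0 hd 2
  rw [div_le_iff₀ (by positivity)]
  calc (k : ℝ) + 1 ≤ (r' - dist (y k) x₁) ^ 2 * ‖X.u (τ k) (y k)‖ := hL k
    _ ≤ r' ^ 2 * ‖X.u (τ k) (y k)‖ := mul_le_mul_of_nonneg_right h1 (norm_nonneg _)
    _ = ‖X.u (τ k) (y k)‖ * r' ^ 2 := mul_comm _ _

end ClayBlowup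

end Summit.NavierStokesRegularity.FluidComputer

end
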